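import Literature.AlgebraicGeometry.Morphisms.SteinFactorizationNoetherianModel
import Literature.AlgebraicGeometry.Limits.ClosedSubschemes
import Literature.AlgebraicGeometry.Limits.IdealSheafExtension
import Literature.AlgebraicGeometry.Limits.SubalgebraDiagram
import HarnessLib

/-!
# Zariski's connectedness theorem over an arbitrary ring: closed subschemes of `P ×_K Spec B`

The Stacks Project proves Tag 03H2 (1) (geometrically connected fibres of the Stein factorisation)
over a non-Noetherian base by Noetherian approximation of the proper morphism (Tags 0A0P, 0A0Q,
09ZR: the proper `X → S` is a limit of proper schemes over bases of finite type over `ℤ`). Here we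
carry this out for the proper schemes that come with an evident approximation: closed subschemes
`Y ↪ P ×_K Spec B` of the base change of a fixed proper `K`-scheme `P` (`K` Noetherian, e.g.
`P = 𝐏^r_K`) to a `K`-algebra `B` — in particular every closed subscheme of `𝐏^r_B`, `B` any ring.

* `exists_fg_le_comap_eq` — for an ideal sheaf `𝓘` on a quasi-compact quasi-separated scheme `X`
  and `ι : X₀ → X` with `X₀` quasi-compact and locally Noetherian, some sub-ideal-sheaf `𝓙 ⊆ 𝓘` OF
  FINITE TYPE has the same pull-back to `X₀` (`𝓘` is the directed union of its finite type
  sub-ideal-sheaves, Stacks 01PG = `Limits.eq_sSup_fgBelow`; pull-back of ideal sheaves is a left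
  adjoint; an ideal sheaf of finite type on a quasi-compact scheme is compact,
  `Limits.exists_le_of_fg_of_le_sSup`).
* `preconnectedSpace_closedFibre_of_isClosedImmersion_tensor` — **the local connectedness core of
  Tag 03H2 (1) for closed subschemes `Y` of `P ×_K Spec B`, `B` local, with `B ≅ Γ(Y, 𝒪_Y)`**: the
  closed fibre `Y ×_B κ_B` is preconnected. Proof: with `𝓘` the ideal of `Y` and `ι` the closed fibre
  `P ×_K Spec κ_B ↪ P ×_K Spec B`, choose `𝓙` as above; `P ×_K Spec B = lim_t P ×_K Spec K[t]` over
  the finitely generated `K`-subalgebras `K[t] ⊆ B` (`Limits.SubalgApprox.isLimitProdCone`,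
  Görtz–Wedhorn I (10.13)), so `V(𝓙)` is the base change of its scheme-theoretic image in some
  `P ×_K Spec K[t]` (`Limits.exists_comap_map_eq`, Görtz–Wedhorn I Prop. 10.75 (1)); then the base
  change `Y⁺` of the scheme-theoretic image `Y'` of `Y` in `P ×_K Spec K[t]` — a proper
  `K[t]`-scheme, `K[t]` Noetherian — satisfies `Y ⊆ Y⁺ ⊆ V(𝓙)`, hence has the same closed fibre as
  `Y`, and `NoetherianModel.preconnectedSpace_closedFibre_of_noetherianModel` applies.
* `geometricallyConnected_of_isClosedImmersion_tensor` — hence (by the reduction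
  `SteinFibre.geometricallyConnected_of_localConn` for the class of all rings) **`g : Y → Spec B` is
  geometrically connected for every ring `B`, every closed `B`-immersion `Y ↪ P ×_K Spec B` and
  `B ≅ Γ(Y, 𝒪_Y)`** — EGA III₁ 4.3.4 / Tag 03H2 (1) without Noetherian hypothesis for such `Y`;
* `geometricallyConnected_of_isClosedImmersion_PP`, `steinFactorization_geometricallyConnected_PP` —
  the case `P = 𝐏^r`: for ANY ring `A` and `f : X → Spec A` with a closed `A`-immersion `X ↪ 𝐏^r_A`,
  `X → Spec Γ(X, 𝒪_X)` — i.e. `f' : X → S'` — is geometrically connected (the named fact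
  `steinFactorization_geometricallyConnected` for projective `f` over affine bases).

Everything is proved; the file declares theorems only; no named facts are introduced.

## References

* The Stacks Project, Tag 03H2 (More on Morphisms, Theorem 37.53.5 (1)); Tag 0G7X; Tags 0A0P, 0A0Q,
  01ZM, 01PG (Limits of Schemes and Properties of Schemes).
* U. Görtz, T. Wedhorn, *Algebraic Geometry I*, 2nd ed. (2020), (10.13), Prop. 10.75.
* A. Grothendieck, J. Dieudonné, EGA IV₃ (1966), Thm. 8.8.2, Thm. 8.10.5; EGA III₁ (1961), 4.3.1–4.3.4.
-/

noncomputable section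

open CategoryTheory AlgebraicGeometry Limits TopologicalSpace Opposite MonoidalCategory
open Literature.AlgebraicGeometry.Limits
open Literature.AlgebraicGeometry.Motives (SchemeOver specOver)

universe u

namespace Literature.AlgebraicGeometry.Morphisms

namespace NoetherianModel

open IsLocalRing Scheme.IdealSheafData

set_option backward.isDefEq.respectTransparency false

/-! ## A finite type sub-ideal-sheaf with the same pull-back to a Noetherian scheme -/

/-- **A sub-ideal-sheaf of finite type with the same pull-back.** For an ideal sheaf `𝓘` on a
quasi-compact quasi-separated scheme `X` and `ι : X₀ → X` with `X₀` quasi-compact and locally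
Noetherian, there is `𝓙 ⊆ 𝓘` of finite type with `𝓙.comap ι = 𝓘.comap ι`: `𝓘` is the directed
supremum of its sub-ideal-sheaves of finite type (Stacks 01PG), `comap ι` preserves suprema (it is a
left adjoint), and the finite type ideal sheaf `𝓘.comap ι` on the quasi-compact `X₀` is a compact
element. [cite: StacksProject, Tag 01PG] -/
theorem exists_fg_le_comap_eq {X X₀ : Scheme.{u}} [CompactSpace X] [QuasiSeparatedSpace X]
    [CompactSpace X₀] [IsLocallyNoetherian X₀] (ι : X₀ ⟶ X) (I : X.IdealSheafData) :
    ∃ J : X.IdealSheafData, (∀ W : X.affineOpens, (J.ideal W).FG) ∧ J ≤ I ∧ J.comap ι = I.comap ι := by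
  have hI := Limits.eq_sSup_fgBelow I
  have hK : ∀ W : X₀.affineOpens, ((I.comap ι).ideal W).FG := fun W => by
    haveI := IsLocallyNoetherian.component_noetherian (X := X₀) W
    exact IsNoetherian.noetherian _
  have hsup : (sSup (Limits.fgBelow I)).comap ι = sSup ((fun J : X.IdealSheafData => J.comap ι) '' Limits.fgBelow I) := by
    rw [(map_gc ι).l_sSup, sSup_image]
  have hle : I.comap ι ≤ sSup ((fun J : X.IdealSheafData => J.comap ι) '' Limits.fgBelow I) := by
    rw [← hsup, ← hI]
  have hdir : DirectedOn (· ≤ ·) ((fun J : X.IdealSheafData => J.comap ι) '' Limits.fgBelow I) := by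
    rintro _ ⟨a, ha, rfl⟩ _ ⟨b, hb, rfl⟩
    obtain ⟨c, hc, hac, hbc⟩ := Limits.directedOn_fgBelow I a ha b hb
    exact ⟨c.comap ι, ⟨c, hc, rfl⟩, comap_mono ι hac, comap_mono ι hbc⟩
  obtain ⟨_, ⟨J, hJ, rfl⟩, hKJ⟩ := Limits.exists_le_of_fg_of_le_sSup (I.comap ι) hK
    (S := (fun J : X.IdealSheafData => J.comap ι) '' Limits.fgBelow I)
    ⟨_, ⊥, Limits.bot_mem_fgBelow I, rfl⟩ hdir hle
  exact ⟨J, hJ.1, hJ.2, le_antisymm (comap_mono ι hJ.2) hKJ⟩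

/-! ## Noetherian models of closed subschemes of `P ×_K Spec B` -/

section Stage

variable {K B : Type u} [CommRing K] [CommRing B] [Algebra K B]
  (P : SchemeOver K) {Y : Scheme.{u}} (jY : Y ⟶ (P ⊗ specOver K B).left)
  (g : Y ⟶ Spec (.of B)) (hg : jY ≫ pullback.snd P.hom (specOver K B).hom = g)
  (i : (SubalgApprox.Idx B (∅ : Finset B))ᵒᵖ)

/-- `P ×_K Spec B` is quasi-compact. [folklore] -/
theorem compactSpace_tensor_left [IsProper P.hom] : CompactSpace ↥(P ⊗ specOver K B).left := by
  haveI : CompactSpace ↥(specOver K B).left := inferInstanceAs (CompactSpace ↥(Spec (.of B)))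
  exact SubalgApprox.compactSpace_tensorObj_left P

/-- `P ×_K Spec B` is quasi-separated. [folklore] -/
theorem quasiSeparatedSpace_tensor_left [IsProper P.hom] : QuasiSeparatedSpace ↥(P ⊗ specOver K B).left := by
  haveI : QuasiSeparatedSpace ↥(specOver K B).left :=
    inferInstanceAs (QuasiSeparatedSpace ↥(Spec (.of B)))
  exact SubalgApprox.quasiSeparatedSpace_tensorObj_left P

/-- The stages `K[t] ⊆ B` are Noetherian. [folklore] -/
theorem isNoetherianRing_sub [IsNoetherianRing K] : IsNoetherianRing ↥(SubalgApprox.sub K B i.unop.1) :=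
  Algebra.FiniteType.isNoetherianRing K _

/-- **The stage square is cartesian**: `P ×_K Spec B → P ×_K Spec K[t]` is the base change of
`Spec B → Spec K[t]` along the projection (`SubalgApprox.isPullback_whiskerLeft_left`). [folklore] -/
theorem isPullback_stage :
    IsPullback ((SubalgApprox.prodCone K B ∅ P).π.app i) (pullback.snd P.hom (specOver K B).hom)
      (pullback.snd P.hom (specOver K ↥(SubalgApprox.sub K B i.unop.1)).hom)
      (Spec.map (CommRingCat.ofHom (SubalgApprox.sub K B i.unop.1).val.toRingHom)) :=
  SubalgApprox.isPullback_whiskerLeft_left P ((SubalgApprox.baseCone K B ∅).π.app i)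

/-- **The model square is cartesian**: with `π : P ×_K Spec B → P ×_K Spec K[t]` the stage map and
`Y' ↪ P ×_K Spec K[t]` the scheme-theoretic image of `Y`, the base change `Y⁺ = Y' ×_{P ×_K Spec K[t]} (P ×_K Spec B)`
is `Y' ×_{K[t]} B`: the square `(Y⁺ → Y', Y⁺ → Spec B, Y' → Spec K[t], Spec B → Spec K[t])` is
cartesian (pasting with `isPullback_stage`). [folklore] -/
theorem isPullback_model :
    IsPullback
      (pullback.snd ((SubalgApprox.prodCone K B ∅ P).π.app i) (jY ≫ (SubalgApprox.prodCone K B ∅ P).π.app i).ker.subschemeι)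
      (pullback.fst ((SubalgApprox.prodCone K B ∅ P).π.app i) (jY ≫ (SubalgApprox.prodCone K B ∅ P).π.app i).ker.subschemeι ≫
        pullback.snd P.hom (specOver K B).hom)
      ((jY ≫ (SubalgApprox.prodCone K B ∅ P).π.app i).ker.subschemeι ≫
        pullback.snd P.hom (specOver K ↥(SubalgApprox.sub K B i.unop.1)).hom)
      (Spec.map (CommRingCat.ofHom (SubalgApprox.sub K B i.unop.1).val.toRingHom)) :=
  (IsPullback.of_hasPullback _ _).flip.paste_vert (isPullback_stage P i)

/-- The comparison `c : Y → Y⁺` commutes with the closed immersions into `P ×_K Spec B`. [folklore] -/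
theorem modelLift_fst :
    pullback.lift jY (jY ≫ (SubalgApprox.prodCone K B ∅ P).π.app i).toImage
        (jY ≫ (SubalgApprox.prodCone K B ∅ P).π.app i).toImage_imageι.symm ≫
      pullback.fst ((SubalgApprox.prodCone K B ∅ P).π.app i) (jY ≫ (SubalgApprox.prodCone K B ∅ P).π.app i).ker.subschemeι =
      jY :=
  pullback.lift_fst _ _ _

include hg in
/-- The comparison `c : Y → Y⁺` is a morphism over `Spec B`. [folklore] -/
theorem modelLift_comp :
    pullback.lift jY (jY ≫ (SubalgApprox.prodCone K B ∅ P).π.app i).toImage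
        (jY ≫ (SubalgApprox.prodCone K B ∅ P).π.app i).toImage_imageι.symm ≫
      (pullback.fst ((SubalgApprox.prodCone K B ∅ P).π.app i) (jY ≫ (SubalgApprox.prodCone K B ∅ P).π.app i).ker.subschemeι ≫
        pullback.snd P.hom (specOver K B).hom) = g := by
  rw [← Category.assoc, modelLift_fst, hg]

/-- The comparison `c : Y → Y⁺` is a closed immersion (its composite with the closed immersion
`Y⁺ → P ×_K Spec B` is `jY`). [folklore] -/
theorem isClosedImmersion_modelLift [IsClosedImmersion jY] :
    IsClosedImmersion (pullback.lift jY (jY ≫ (SubalgApprox.prodCone K B ∅ P).π.app i).toImage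
        (jY ≫ (SubalgApprox.prodCone K B ∅ P).π.app i).toImage_imageι.symm) := by
  haveI : IsClosedImmersion (pullback.fst ((SubalgApprox.prodCone K B ∅ P).π.app i)
      (jY ≫ (SubalgApprox.prodCone K B ∅ P).π.app i).ker.subschemeι) :=
    MorphismProperty.pullback_fst _ _ inferInstance
  haveI : IsClosedImmersion (pullback.lift jY (jY ≫ (SubalgApprox.prodCone K B ∅ P).π.app i).toImage
        (jY ≫ (SubalgApprox.prodCone K B ∅ P).π.app i).toImage_imageι.symm ≫
      pullback.fst ((SubalgApprox.prodCone K B ∅ P).π.app i)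
        (jY ≫ (SubalgApprox.prodCone K B ∅ P).π.app i).ker.subschemeι) := by
    rw [modelLift_fst]; infer_instance
  exact IsClosedImmersion.of_comp _ (pullback.fst ((SubalgApprox.prodCone K B ∅ P).π.app i)
    (jY ≫ (SubalgApprox.prodCone K B ∅ P).π.app i).ker.subschemeι)

/-- **There is a stage from which on the models have the closed fibre of `Y`**: a finite type
`𝓙 ⊆ 𝓘_Y` with the same pull-back to the closed fibre `P ×_K Spec κ_B` (`exists_fg_le_comap_eq`)
descends to some stage and all later ones (`Limits.exists_comap_map_eq`, Görtz–Wedhorn I, Prop.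
10.75 (1)). [cite: GortzWedhorn2020, Prop. 10.75 (1), p. 333] -/
theorem exists_stage [IsLocalRing B] [IsProper P.hom] :
    ∃ i : (SubalgApprox.Idx B (∅ : Finset B))ᵒᵖ, ∀ (j : (SubalgApprox.Idx B (∅ : Finset B))ᵒᵖ) (_ : j ⟶ i),
      ∃ J : ((P ⊗ specOver K B).left).IdealSheafData, J ≤ jY.ker ∧
        J.comap (pullback.fst (pullback.snd P.hom (specOver K B).hom) (Spec.map (CommRingCat.ofHom (residue B)))) =
          jY.ker.comap (pullback.fst (pullback.snd P.hom (specOver K B).hom) (Spec.map (CommRingCat.ofHom (residue B)))) ∧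
        (J.map ((SubalgApprox.prodCone K B ∅ P).π.app j)).comap ((SubalgApprox.prodCone K B ∅ P).π.app j) = J := by
  classical
  haveI := compactSpace_tensor_left (B := B) P
  haveI := quasiSeparatedSpace_tensor_left (B := B) P
  let pB : (P ⊗ specOver K B).left ⟶ Spec (.of B) := pullback.snd P.hom (specOver K B).hom
  let q := Spec.map (CommRingCat.ofHom (residue B))
  haveI : CompactSpace ↥(pullback pB q) := QuasiCompact.compactSpace_of_compactSpace (pullback.snd pB q)
  haveI : IsLocallyNoetherian (pullback pB q) := LocallyOfFiniteType.isLocallyNoetherian (pullback.snd pB q)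
  obtain ⟨J, hJfg, hJI, hJcomap⟩ := exists_fg_le_comap_eq (pullback.fst pB q) jY.ker
  obtain ⟨i, hi⟩ := Limits.exists_comap_map_eq (SubalgApprox.prodDiagram K B ∅ P)
    (SubalgApprox.prodCone K B ∅ P) (SubalgApprox.isLimitProdCone K B ∅ P) J hJfg
  exact ⟨i, fun j φ => ⟨J, hJI, hJcomap, hi j φ⟩⟩

/-- **At such a stage the comparison `Y₀ → Y⁺₀` of closed fibres is onto**: `𝓙 ≤ 𝓘_{Y⁺} ≤ 𝓘_Y` with
`𝓙` and `𝓘_Y` having the same pull-back to the closed fibre of `P ×_K Spec B`, so `Y` and `Y⁺` have the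
same closed fibre (supports of pulled-back ideal sheaves; points of the fibre products).
[cite: StacksProject, Tag 0A0Q (Limits of Schemes, Lemma lemma-proper-limit-of-proper-finite-presentation-noetherian), the case of closed subschemes of P x Spec B] -/
theorem surjective_modelLift_map [IsLocalRing B] [IsClosedImmersion jY]
    (hi : ∃ J : ((P ⊗ specOver K B).left).IdealSheafData, J ≤ jY.ker ∧
        J.comap (pullback.fst (pullback.snd P.hom (specOver K B).hom) (Spec.map (CommRingCat.ofHom (residue B)))) =
          jY.ker.comap (pullback.fst (pullback.snd P.hom (specOver K B).hom) (Spec.map (CommRingCat.ofHom (residue B)))) ∧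
        (J.map ((SubalgApprox.prodCone K B ∅ P).π.app i)).comap ((SubalgApprox.prodCone K B ∅ P).π.app i) = J) :
    Function.Surjective (pullback.map g (Spec.map (CommRingCat.ofHom (residue B)))
      (pullback.fst ((SubalgApprox.prodCone K B ∅ P).π.app i) (jY ≫ (SubalgApprox.prodCone K B ∅ P).π.app i).ker.subschemeι ≫
        pullback.snd P.hom (specOver K B).hom)
      (Spec.map (CommRingCat.ofHom (residue B)))
      (pullback.lift jY (jY ≫ (SubalgApprox.prodCone K B ∅ P).π.app i).toImage
        (jY ≫ (SubalgApprox.prodCone K B ∅ P).π.app i).toImage_imageι.symm) (𝟙 _) (𝟙 _)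
      (by rw [Category.comp_id, modelLift_comp P jY g hg i]) (by rw [Category.comp_id, Category.id_comp])) := by
  set q := Spec.map (CommRingCat.ofHom (residue B)) with hq
  haveI : IsClosedImmersion q := IsClosedImmersion.spec_of_surjective _ Ideal.Quotient.mk_surjective
  obtain ⟨J, hJI, hJcomap, hJ⟩ := hi
  -- notation
  let pB : (P ⊗ specOver K B).left ⟶ Spec (.of B) := pullback.snd P.hom (specOver K B).hom
  let ιk := pullback.fst pB q
  let π : (P ⊗ specOver K B).left ⟶ (SubalgApprox.prodDiagram K B ∅ P).obj i :=
    (SubalgApprox.prodCone K B ∅ P).π.app i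
  let K' := (jY ≫ π).ker
  let gp : pullback π K'.subschemeι ⟶ Spec (.of B) := pullback.fst π K'.subschemeι ≫ pB
  let c : Y ⟶ pullback π K'.subschemeι :=
    pullback.lift jY (jY ≫ π).toImage (jY ≫ π).toImage_imageι.symm
  have hcfst : c ≫ pullback.fst π K'.subschemeι = jY := pullback.lift_fst _ _ _
  haveI : IsClosedImmersion (pullback.fst π K'.subschemeι) := MorphismProperty.pullback_fst _ _ inferInstance
  -- `𝓙 ≤ 𝓘⁺ ≤ 𝓘`
  have hK' : K' = jY.ker.map π := (map_ker jY π).symm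
  have hIp : (pullback.fst π K'.subschemeι).ker = K'.comap π := rfl
  have hJle : J ≤ K'.comap π := by
    rw [← hJ, hK']
    exact comap_mono π (map_mono π hJI)
  have hIple : K'.comap π ≤ jY.ker := by rw [hK']; exact comap_map_le _ _
  have hcomapeq : (K'.comap π).comap ιk = jY.ker.comap ιk :=
    le_antisymm (comap_mono ιk hIple) (hJcomap ▸ comap_mono ιk hJle)
  haveI : IsClosedImmersion (pullback.fst gp q) := MorphismProperty.pullback_fst _ _ inferInstance
  intro z
  -- `x = fst (fst z) ∈ X` lies over the closed point: `x = ιk xk`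
  have hxq : pB (pullback.fst π K'.subschemeι (pullback.fst gp q z)) ∈ Set.range q := by
    refine ⟨pullback.snd gp q z, ?_⟩
    rw [← Scheme.Hom.comp_apply, ← pullback.condition]
    rfl
  obtain ⟨xk, hxk⟩ : pullback.fst π K'.subschemeι (pullback.fst gp q z) ∈ Set.range ιk := by
    rw [Scheme.Pullback.range_fst]; exact hxq
  -- `xk ∈ supp (𝓘⁺.comap ιk) = supp (𝓘.comap ιk)`, so `x ∈ Y`
  have h1 : ιk xk ∈ ((K'.comap π).support : Set _) := by
    rw [← hIp, Scheme.Hom.support_ker, hxk]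
    exact subset_closure ⟨_, rfl⟩
  have h2 : xk ∈ (((K'.comap π).comap ιk).support : Set _) := by
    rw [support_comap]; exact h1
  rw [hcomapeq, support_comap] at h2
  have h3 : ιk xk ∈ Set.range jY := by
    have h2' : ιk xk ∈ (jY.ker.support : Set _) := h2
    rwa [Scheme.Hom.support_ker, jY.isClosedEmbedding.isClosed_range.closure_eq] at h2'
  obtain ⟨y, hy⟩ := h3
  -- `y` lies over the closed point; lift it to the closed fibre of `Y`
  have hgy : g y = q (pullback.snd gp q z) := by
    rw [← hg, Scheme.Hom.comp_apply, hy, hxk, ← Scheme.Hom.comp_apply, ← Scheme.Hom.comp_apply,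
      ← Category.assoc]
    change (pullback.fst gp q ≫ gp) z = _
    rw [pullback.condition, Scheme.Hom.comp_apply]
  obtain ⟨y₀, hy₀, -⟩ := Scheme.Pullback.exists_preimage_pullback (f := g) (g := q) y (pullback.snd gp q z) hgy
  refine ⟨y₀, ?_⟩
  apply (pullback.fst gp q).isClosedEmbedding.injective
  apply (pullback.fst π K'.subschemeι).isClosedEmbedding.injective
  rw [← Scheme.Hom.comp_apply, ← Scheme.Hom.comp_apply, ← Category.assoc, pullback.lift_fst,
    Category.assoc, hcfst, Scheme.Hom.comp_apply, hy₀, hy, hxk]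

end Stage

/-! ## Closed subschemes of `P ×_K Spec B` over a local ring `B` -/

/-- **The local connectedness core of Tag 03H2 (1) for closed subschemes of `P ×_K Spec B`.** Let
`K` be a Noetherian ring, `P` a proper `K`-scheme, `B` a local `K`-algebra, `jY : Y ↪ P ×_K Spec B` a
closed immersion and `g : Y → Spec B` the structure map, with `B ≅ Γ(Y, 𝒪_Y)`. Then the closed
fibre `Y ×_B κ_B` is preconnected. Proof (Noetherian approximation, Stacks Tags 0G7X/0A0Q for these
`Y`): choose a finite type `𝓙 ⊆ 𝓘_Y` with the same pull-back to the closed fibre `P ×_K Spec κ_B`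
and descend `V(𝓙)` to a stage `P ×_K Spec K[t]` of the limit `P ×_K Spec B = lim_t P ×_K Spec K[t]`
(`exists_stage`); the base change `Y⁺` of the scheme-theoretic image `Y'` of `Y` in `P ×_K Spec K[t]`
(proper over the Noetherian ring `K[t]`) receives a closed immersion from `Y` which is onto on closed
fibres (`surjective_modelLift_map`), and `preconnectedSpace_closedFibre_of_noetherianModel` applies.
[cite: StacksProject, Tag 0G7X (Derived Categories of Schemes, Lemma lemma-proper-idempotent-on-fibre, general case) and Tag 03H2 (More on Morphisms, Theorem 37.53.5 (1), proof)] -/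
theorem preconnectedSpace_closedFibre_of_isClosedImmersion_tensor
    {K B : Type u} [CommRing K] [IsNoetherianRing K] [CommRing B] [IsLocalRing B] [Algebra K B]
    (P : SchemeOver K) [IsProper P.hom] {Y : Scheme.{u}}
    (jY : Y ⟶ (P ⊗ specOver K B).left) [IsClosedImmersion jY]
    (g : Y ⟶ Spec (.of B)) (hg : jY ≫ pullback.snd P.hom (specOver K B).hom = g) [IsIso g.appTop] :
    PreconnectedSpace ↥(pullback g (Spec.map (CommRingCat.ofHom (residue B)))) := by
  obtain ⟨i, hi⟩ := exists_stage P jY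
  haveI := isNoetherianRing_sub (K := K) (B := B) i
  haveI := isClosedImmersion_modelLift P jY i
  exact preconnectedSpace_closedFibre_of_noetherianModel (SubalgApprox.sub K B i.unop.1).val.toRingHom
    _ _ _ (isPullback_model P jY i) g _ (modelLift_comp P jY g hg i)
    (surjective_modelLift_map P jY g hg i (hi i (𝟙 i)))

/-! ## Geometric connectedness over an arbitrary ring -/

/-- **EGA III₁ 4.3.4 / Tag 03H2 (1) without Noetherian hypothesis, for closed subschemes of
`P ×_K Spec B`.** Let `K` be a Noetherian ring, `P` a proper `K`-scheme, `B` ANY `K`-algebra,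
`jY : Y ↪ P ×_K Spec B` a closed immersion with structure map `g : Y → Spec B`, and `B ≅ Γ(Y, 𝒪_Y)`.
Then `g` is geometrically connected. Proof: the reduction `SteinFibre.geometricallyConnected_of_localConn`
(`Literature/AlgebraicGeometry/Morphisms/SteinFactorizationLocalCriterion.lean`) for the class of ALL rings
and the class `𝒞` of morphisms admitting such a closed immersion for some `K`-algebra structure (stable
under base change `B → B'`: `P ×_K Spec B' = (P ×_K Spec B) ×_B Spec B'`,
`SubalgApprox.isPullback_whiskerLeft_left`), whose local core is
`preconnectedSpace_closedFibre_of_isClosedImmersion_tensor`.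
[cite: StacksProject, Tag 03H2 (More on Morphisms, Theorem 37.53.5 (1), general base)] -/
theorem geometricallyConnected_of_isClosedImmersion_tensor
    {K B : Type u} [CommRing K] [IsNoetherianRing K] [CommRing B] [Algebra K B]
    (P : SchemeOver K) [IsProper P.hom] {Y : Scheme.{u}}
    (jY : Y ⟶ (P ⊗ specOver K B).left) [IsClosedImmersion jY]
    (g : Y ⟶ Spec (.of B)) (hg : jY ≫ pullback.snd P.hom (specOver K B).hom = g) [IsIso g.appTop] :
    GeometricallyConnected g := by
  haveI : IsProper g := by rw [← hg]; infer_instance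
  refine SteinFibre.geometricallyConnected_of_localConn (𝒩 := fun _ _ ↦ True)
    (𝒞 := fun B _ Y g ↦ ∃ (alg : Algebra K B) (j : Y ⟶ (P ⊗ @specOver K _ B _ alg).left),
      IsClosedImmersion j ∧ j ≫ pullback.snd P.hom (@specOver K _ B _ alg).hom = g)
    (fun _ _ _ _ _ ↦ trivial) (fun _ _ _ _ _ ↦ trivial) ?_ ?_ trivial g ⟨inferInstance, jY, inferInstance, hg⟩
  · -- `𝒞` is stable under base change
    rintro B B' _ _ φ Y g ⟨alg, j, hjc, hjg⟩
    letI := alg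
    letI alg' : Algebra K B' := (φ.comp (algebraMap K B)).toAlgebra
    haveI := hjc
    let gφ : specOver K B' ⟶ specOver K B := Over.homMk (Spec.map (CommRingCat.ofHom φ)) (by
      change Spec.map _ ≫ Spec.map _ = Spec.map _
      rw [← Spec.map_comp]
      rfl)
    have sqW : IsPullback (P ◁ gφ).left (pullback.snd P.hom (specOver K B').hom)
        (pullback.snd P.hom (specOver K B).hom) (Spec.map (CommRingCat.ofHom φ)) :=
      SubalgApprox.isPullback_whiskerLeft_left P gφ
    have s : IsPullback (pullback.fst g (Spec.map (CommRingCat.ofHom φ)))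
        (pullback.snd g (Spec.map (CommRingCat.ofHom φ))) (j ≫ pullback.snd P.hom (specOver K B).hom)
        (Spec.map (CommRingCat.ofHom φ)) := by
      rw [hjg]; exact IsPullback.of_hasPullback _ _
    have top := IsPullback.of_bot' s sqW
    refine ⟨alg', sqW.lift (pullback.fst g (Spec.map (CommRingCat.ofHom φ)) ≫ j)
      (pullback.snd g (Spec.map (CommRingCat.ofHom φ))) (by rw [Category.assoc, s.w]), ?_, sqW.lift_snd _ _ _⟩
    exact MorphismProperty.of_isPullback top inferInstance
  · -- the local core
    rintro B _ _ - Y g _ ⟨alg, j, hjc, hjg⟩ hiso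
    letI := alg
    haveI := hjc
    haveI := hiso
    exact preconnectedSpace_closedFibre_of_isClosedImmersion_tensor P j g hjg

/-! ## Projective schemes over an arbitrary ring -/

/-- **Zariski's connectedness theorem for projective schemes over ANY ring** (EGA III₁ Cor. 4.3.4 with the
Noetherian hypothesis removed, as in The Stacks Project, Tag 03H2): for a ring `A` and `f : X → Spec A`
admitting a closed `A`-immersion `X ↪ 𝐏^r_A`, if `A → Γ(X, 𝒪_X)` is an isomorphism then `f` is
geometrically connected. (`𝐏^r_A = 𝐏^r_ℤ ×_ℤ Spec A`, `Motives.ProjBaseChangeRing.isPullback_projMap'`,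
and `geometricallyConnected_of_isClosedImmersion_tensor` with `K = ℤ`.)
[cite: StacksProject, Tag 03H2 (More on Morphisms, Theorem 37.53.5 (1), general base)] -/
theorem geometricallyConnected_of_isClosedImmersion_PP {A : Type u} [CommRing A] {X : Scheme.{u}}
    (f : X ⟶ Spec (.of A)) {r : ℕ} (j : X ⟶ ProjCech.PP A r) [IsClosedImmersion j]
    (hj : j ≫ ProjCech.toSpec A r = f) [IsIso f.appTop] : GeometricallyConnected f := by
  letI : Algebra (ULift.{u} ℤ) A :=
    ((Int.castRingHom A).comp (ULift.ringEquiv : ULift.{u} ℤ ≃+* ℤ).toRingHom).toAlgebra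
  haveI : IsNoetherianRing (ULift.{u} ℤ) := isNoetherianRing_of_ringEquiv ℤ ULift.ringEquiv.symm
  let P : SchemeOver (ULift.{u} ℤ) := Over.mk (ProjCech.toSpec (ULift.{u} ℤ) r)
  haveI : IsProper P.hom := Motives.ProjBaseChangeRing.isProper_projToSpec (Fin (r + 1)) (ULift.{u} ℤ)
  have H := Motives.ProjBaseChangeRing.isPullback_projMap' (ULift.{u} ℤ) A (n := r)
  have H' : IsPullback (pullback.fst P.hom (specOver (ULift.{u} ℤ) A).hom)
      (pullback.snd P.hom (specOver (ULift.{u} ℤ) A).hom) (ProjCech.toSpec (ULift.{u} ℤ) r)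
      (Spec.map (CommRingCat.ofHom (algebraMap (ULift.{u} ℤ) A))) :=
    IsPullback.of_hasPullback _ _
  let e := H.isoIsPullback _ _ H'
  have he : e.hom ≫ pullback.snd P.hom (specOver (ULift.{u} ℤ) A).hom = ProjCech.toSpec A r :=
    H.isoIsPullback_hom_snd _ _ H'
  exact geometricallyConnected_of_isClosedImmersion_tensor P (j ≫ e.hom) f
    (by rw [Category.assoc, he, hj])

/-- **The Stacks Project, Tag 03H2 (1) for projective morphisms over an affine base, any ring.** For
`f : X → Spec A` proper admitting a closed `A`-immersion `X ↪ 𝐏^r_A` (`A` any ring), the morphism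
`f' : X → S'` to the normalisation `S'` of `Spec A` in `X` is geometrically connected — the statement of
the named fact `steinFactorization_geometricallyConnected` for such `f` (the tree's
`steinFactorization_geometricallyConnected_projective` without the Noetherian hypothesis). Proof:
`S' = Spec Γ(X, 𝒪_X)` (Tag 03GY (3)–(4)), `X` is projective over `Γ(X, 𝒪_X)`
(`ZariskiProj.exists_isClosedImmersion_of_factor`), and `geometricallyConnected_of_isClosedImmersion_PP`
applies. [cite: StacksProject, Tag 03H2 (More on Morphisms, Theorem 37.53.5 (1))] -/
theorem steinFactorization_geometricallyConnected_PP {A : Type u} [CommRing A] {X : Scheme.{u}}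
    (f : X ⟶ Spec (.of A)) [IsProper f] {r : ℕ} (j : X ⟶ ProjCech.PP A r) [IsClosedImmersion j]
    (hj : j ≫ ProjCech.toSpec A r = f) : GeometricallyConnected f.toNormalization := by
  -- `S'` is affine and `Γ(S') ≅ Γ(X)`
  haveI : IsAffine f.normalization := isAffine_of_isAffineHom f.fromNormalization
  have h1 : IsIso (f.toNormalization.app (f.fromNormalization ⁻¹ᵁ ⊤)) :=
    isIso_toNormalization_app f ⟨⊤, isAffineOpen_top _⟩
  haveI h2 : IsIso f.toNormalization.appTop := h1
  have h3 : IsIso (f.normalization.isoSpec.hom).appTop := by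
    show IsIso ((f.normalization.isoSpec.hom).app ⊤); infer_instance
  -- `g : X → Spec Γ(S')`
  let g : X ⟶ Spec (CommRingCat.of Γ(f.normalization, ⊤)) :=
    f.toNormalization ≫ f.normalization.isoSpec.hom
  have hgI : IsIso g.appTop := by
    show IsIso (f.toNormalization ≫ f.normalization.isoSpec.hom).appTop
    rw [Scheme.Hom.comp_appTop]; exact IsIso.comp_isIso' h3 h2
  -- `X` is projective over `Γ(S')`
  have w : j ≫ ProjCech.toSpec A r = g ≫ Spec.map (CommRingCat.ofHom (algebraMapΓ f.fromNormalization)) := by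
    show _ = (f.toNormalization ≫ f.normalization.toSpecΓ) ≫ _
    rw [hj, Category.assoc, ZariskiProj.toSpecΓ_SpecMap_algebraMapΓ, Scheme.Hom.toNormalization_fromNormalization]
  obtain ⟨j', hj'c, hj'g⟩ := ZariskiProj.exists_isClosedImmersion_of_factor j g (algebraMapΓ f.fromNormalization) w
  haveI := hj'c
  have hgc : GeometricallyConnected g := @geometricallyConnected_of_isClosedImmersion_PP _ _ _ g r j' hj'c hj'g hgI
  have e : f.toNormalization = g ≫ f.normalization.isoSpec.inv := by
    simp only [g, Category.assoc, Iso.hom_inv_id, Category.comp_id]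
  rw [e]
  exact MorphismProperty.RespectsIso.postcomp (P := @GeometricallyConnected) _ _ hgc

/-- **The Stacks Project, Tag 03H2 (1) with (5), for locally projective proper morphisms to an
arbitrary scheme.** Let `f : X → S` be proper and locally projective in the sense that over every
affine open `U ⊆ S` the restriction `f⁻¹U → U ≅ Spec Γ(U, 𝒪_S)` admits a closed `Γ(U, 𝒪_S)`-immersion
into some `𝐏^r_{Γ(U, 𝒪_S)}`. Then `f' = f.toNormalization : X → S'` has geometrically connected fibres —
the statement of the named fact `steinFactorization_geometricallyConnected` for such `f`, over ANY `S`.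
Proof: by `geometricallyConnected_toNormalization_of_forall_affineOpens` it suffices that
`f⁻¹U → Spec Γ(f⁻¹U, 𝒪)` be geometrically connected; `f⁻¹U` is projective over `Γ(f⁻¹U, 𝒪)`
(`ZariskiProj.exists_isClosedImmersion_of_factor`) and `geometricallyConnected_of_isClosedImmersion_PP`
applies. [cite: StacksProject, Tag 03H2 (More on Morphisms, Theorem 37.53.5 (1) and (5))] -/
theorem steinFactorization_geometricallyConnected_of_locallyProjective {X S : Scheme.{u}} (f : X ⟶ S)
    [IsProper f]
    (hproj : ∀ U : S.affineOpens, ∃ (r : ℕ)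
      (j : (f ⁻¹ᵁ (U : S.Opens)).toScheme ⟶ ProjCech.PP Γ((U : S.Opens).toScheme, ⊤) r),
      IsClosedImmersion j ∧ j ≫ ProjCech.toSpec Γ((U : S.Opens).toScheme, ⊤) r =
        (f ∣_ (U : S.Opens)) ≫ (@Scheme.isoSpec (U : S.Opens).toScheme U.2).hom) :
    GeometricallyConnected f.toNormalization := by
  refine geometricallyConnected_toNormalization_of_forall_affineOpens f fun U ↦ ?_
  haveI : IsAffine (U : S.Opens) := U.2
  obtain ⟨r, j, hjc, hjg⟩ := hproj U
  haveI := hjc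
  let gU : (f ⁻¹ᵁ (U : S.Opens)).toScheme ⟶ Spec Γ((U : S.Opens).toScheme, ⊤) :=
    (f ∣_ (U : S.Opens)) ≫ (U : S.Opens).toScheme.isoSpec.hom
  have w : j ≫ ProjCech.toSpec Γ((U : S.Opens).toScheme, ⊤) r =
      (f ⁻¹ᵁ (U : S.Opens)).toScheme.toSpecΓ ≫ Spec.map (CommRingCat.ofHom (algebraMapΓ gU)) := by
    rw [hjg, ZariskiProj.toSpecΓ_SpecMap_algebraMapΓ]
  obtain ⟨j', hj'c, hj'g⟩ := ZariskiProj.exists_isClosedImmersion_of_factor j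
    (f ⁻¹ᵁ (U : S.Opens)).toScheme.toSpecΓ (algebraMapΓ gU) w
  haveI := hj'c
  haveI : IsIso (f ⁻¹ᵁ (U : S.Opens)).toScheme.toSpecΓ.appTop := by
    rw [Scheme.toSpecΓ_appTop]; infer_instance
  exact geometricallyConnected_of_isClosedImmersion_PP _ j' hj'g

end NoetherianModel

end Literature.AlgebraicGeometry.Morphisms

end
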